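import Mathlib
import Literature.Computability.AlgebraicComplexity.EquivariantDC
import Literature.Computability.AlgebraicComplexity.StandardFamilies

/-!
# The tied tori and the graded family `TiedTorusBound k` — definitions
# (crux `RankRigidMinimalRepr`, stmt-ValiantsHypothesis-18034, route `RigidityForcesSymmetry`)

Verbatim tree copies of the remaining objects of the crux workfile `Cruxes/RankRigidMinimalRepr/Lines/PairTiedTorusBound.lean`
(`Theorems/` cannot import `Cruxes/`; companion of `…PairTiedTorusBoundDefs.lean`, which copies `IsTiedTyped` /
`TiedLevelDecomposable`):

* `tiedTorusGen m k`, `tiedTorus m k` — the two-sided torus `x_{kj} ↦ d_k e_j x_{kj}` with the column scalars `e_0, …, e_k` tied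
  (generators and the subgroup they generate inside `GL(m²)`);
* `EquivariantGrenetBound H` — Grenet's bound `2^m - 1 ≤ n` for every `H m`-equivariant (exact lifts, `IsEquivariantDetRepr`)
  affine determinantal representation of `perm_m`, `m ≥ 3`;
* `TiedTorusBound k := EquivariantGrenetBound (fun m => tiedTorus m k)` — the graded family; `k = 0` is the PROVED floor
  `RigidityForcesSymmetry.TorusBound`, `k = 1` is the rung `PairTiedTorusBound`.

Same binder names, order and bodies as the workfile, so the statements transfer by `rfl` once the workfile is re-pointed.  Used by
`…RankRigidMinimalReprTiedTorusBoundOfLevelDecomp.lean` (the rungs `k = 1, 2` from the dictionary stub alone, the level counts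
being landed).  HONEST FRAMING: definitions only; nothing of the crux or of `VP ≠ VNP` is asserted.
[cite: LandsbergRessayre2017, Def. 1.3, §6]
-/

set_option autoImplicit false

-- the mandated summit-side namespace repeats a component by design (single-problem summit)
set_option linter.dupNamespace false

namespace Summit.ValiantsHypothesis.ValiantsHypothesis.Theorems.RigidityForcesSymmetryPairTiedTorusBound

open Literature.Computability.AlgebraicComplexity

/-- Generators of the two-sided torus `x_{kj} ↦ d_k e_j x_{kj}` whose column scalars are tied on the columns `j ≤ k`
(`e j = e j'` whenever `j, j' ≤ k`).  Verbatim the workfile's `tiedTorusGen`. -/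
def tiedTorusGen (m k : ℕ) : Set (GL (Fin m × Fin m) ℂ) :=
  {γ | ∃ d e : Fin m → ℂ, (∀ j j' : Fin m, j.val ≤ k → j'.val ≤ k → e j = e j') ∧
    (γ : Matrix (Fin m × Fin m) (Fin m × Fin m) ℂ) = Matrix.diagonal (fun p => d p.1 * e p.2)}

/-- The tied torus: subgroup generated by `tiedTorusGen m k`.  Verbatim the workfile's `tiedTorus`. -/
def tiedTorus (m k : ℕ) : Subgroup (GL (Fin m × Fin m) ℂ) :=
  Subgroup.closure (tiedTorusGen m k)

/-- Grenet's bound `2^m - 1 ≤ n` for every `H m`-equivariant affine determinantal representation of `perm_m`, `m ≥ 3` (the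
shape of `TorusBound`, with the symmetry group as a parameter).  Verbatim the workfile's `EquivariantGrenetBound`. -/
def EquivariantGrenetBound (H : ∀ m : ℕ, Subgroup (GL (Fin m × Fin m) ℂ)) : Prop :=
  ∀ m : ℕ, 3 ≤ m → ∀ (n : ℕ) (A : Matrix (Fin n) (Fin n) (MvPolynomial (Fin m × Fin m) ℂ)),
    IsEquivariantDetRepr (H m) (perPoly (Fin m) ℂ) A → 2 ^ m - 1 ≤ n

/-- The graded family: Grenet's bound under the torus with the first `k+1` columns tied.  Verbatim the workfile's
`TiedTorusBound`; `TiedTorusBound 1` is the rung `PairTiedTorusBound`. -/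
def TiedTorusBound (k : ℕ) : Prop :=
  EquivariantGrenetBound (fun m => tiedTorus m k)

end Summit.ValiantsHypothesis.ValiantsHypothesis.Theorems.RigidityForcesSymmetryPairTiedTorusBound
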